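import Summits.ABC.ABC.Theses.IsogenyGlueCongruence
import Summits.ABC.ABC.Theorems.IsogenyGlueCongruencePolyDegreeOfBoundedPrimesHeightCalibrationExact
import Literature.NumberTheory.Automorphic.ShimuraCurveRibetTakahashiSemistableManinProofs
import Literature.NumberTheory.EllipticCurves.EichlerShimuraConstruction
import HarnessLib

/-!
# Crux B (`PolyDegreeOfBoundedPrimes`, stmt-ABC-2046), line `Sketch` v7 — the MANIN-RELATIVE calibration, I:
# `B' ↔ (A → deg φ ≤ C · c² · N^κ)` fact-free, and `deg_{D'} · c_D² = deg_D · c_{D'}²`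

Lead c5 (cycle 6, 2026-08-17); the content was requested and certified in sketch form by the route-choice
planner (rchoice 8cb3b1b0, evidence `RewirePolyDegreeManinRelative.lean` on stmt-ABC-2046, 2026-08-16T17:14Z:
"LEAD OF LINE Sketch: your line needs NO Edixhoven / Česnavičius / Néron-scaling / optimal-curve step …
land the file's theorems `--supports stmt-ABC-2046`"), and is already cited as landed by the disprover of the
sibling crux B' (`Cruxes/PolyHeightOfBoundedPrimes/Disproof.lean` §2e). It is proved here from scratch over
tree theorems only (Zagier's identity `zagier_degree_formula_holds`, the Petersson upper bound at square-free
level `exists_petersson_le_mul_log_pow_of_squarefree`, the Hoffstein–Lockhart range `η = 3/4`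
`HoffsteinLockhart1994_peterssonProduct_lower_bound_of_half_lt`, Silverman's two covolume inequalities,
uniqueness of the newform `IsNewformOf.unique` and of the Néron lattice `IsNeronLatticeOf.lattice_eq`).

Notation: `A = DegreePrimesPolyBounded`, `B = PolyDegreeOfBoundedPrimes = (A → P)`,
`B' = PolyHeightOfBoundedPrimes = (A → H)`, `SMB2 = SemistableManinBound2`; `P`, `H`, `M` as in
`…PolyDegreeOfBoundedPrimesOfHeightAndManinItems`; and the NEW Manin-relative degree statement

* `Prel` = `∃ κ C, ∀ W semistable globally minimal, ∃ D, deg D ≤ C · c_D² · N_W^κ`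
  (polynomial modular degree UP TO the square of the datum's own Manin constant).

Results (no definition, no named fact, no `sorry`):

* `modularDegree_mul_sq_maninConstant_eq` — **Zagier twice**: two data `D, D'` of one elliptic `W` at one
  level have the same newform and the same lattice, so `deg D' · c_D² = deg D · c_{D'}²` (the ratio `deg/c²`
  is an invariant of `(W, N)`: `4π² (f,f) / covol(Λ_W)`).
* `degLe_sq_manin_of_height` — the **c²-relative per-datum Murty bound**, fact-free: for height data `(σ, C_H)`
  there are `κ, K` with `deg D ≤ K · c_D² · N^κ` for EVERY datum `D` at a square-free level `N` of an elliptic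
  `W/ℚ` with `max(|Δ_W|, |c₄(W)|³) ≤ C_H · N^σ` (Zagier, Petersson upper bound, Silverman lower covolume bound).
* `polyHeight_of_polyDegreeUpToManin` — **`Prel → H`** (Zagier, Hoffstein–Lockhart, Silverman upper bound on
  the global minimal model; the Manin constant CANCELS, cf. `covolume_ge_of_zagier_exp`).
* `polyHeightOfBoundedPrimes_iff_polyDegreeUpToManin` — **`B' ↔ (A → Prel)`, FACT-FREE** ★: the height
  re-cut B' of crux B is ITSELF a modular-degree statement — crux B with `deg` replaced by `deg / c²`. So the
  hypothesis A of B' can act on B' only through the prime factors of the integer `deg φ` whose size `deg φ / c²`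
  B' bounds (read with `Cruxes/PolyHeightOfBoundedPrimes/Disproof.lean` §2e).
* (companion file `…ManinRelativeSplit`: `Prel → M → P` by Zagier twice and the split `B ↔ ((A → Prel) ∧ (A → SMB2))`.)

## References

* D. Zagier, *Modular parametrizations of elliptic curves*, Canad. Math. Bull. 28 (1985), §1. [ZagierCMB1985]
* M. R. Murty, *Bounds for congruence primes* (1999), Thm. 1, §2. [MurtyCongruencePrimes1999]
* J. H. Silverman, *Heights and elliptic curves*, in: Arithmetic Geometry (1986), Prop. 1.1, Cor. 2.3.
  [Silverman1986]
* J. Hoffstein, P. Lockhart, *Coefficients of Maass forms and the Siegel zero*, Ann. of Math. 140 (1994).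
  [HoffsteinLockhart1994]
* H. Pasten, *Shimura curves and the abc conjecture*, J. Number Theory 254 (2024), §3, Conj. 3.1–3.2.
  [PastenShimura2024]
-/

noncomputable section

-- single-conjunct summit ABC: the duplicate ABC.ABC is mandated (CONVENTIONS §2)
set_option linter.dupNamespace false

namespace Summit.ABC.ABC.Theorems

open Literature.NumberTheory.EllipticCurves Literature.NumberTheory.EllipticCurves.ModularForms
open CongruenceSubgroup
open Summit.ABC.ABC.Theses.IsogenyGlueCongruence

/-! ## Zagier twice: `deg / c²` is an invariant of `(W, N)` -/

/-- **`deg D' · c_D² = deg D · c_{D'}²` for two data of one elliptic `W/ℚ` at one level.** Both data carry the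
newform of `W` (`IsNewformOf.unique`) and span the Néron lattice of the model `W` (`IsNeronLatticeOf.lattice_eq`),
so Zagier's identity `4π² c² (f,f) = deg · covol(Λ_W)` for each (`zagier_degree_formula_holds`) gives the claim
after cancelling `covol(Λ_W) > 0`. [cite: ZagierCMB1985, §1 (p. 374)] -/
theorem modularDegree_mul_sq_maninConstant_eq {N : ℕ} [NeZero N] {W : WeierstrassCurve ℚ} [W.IsElliptic]
    (D D' : ModularParametrizationData W N) :
    (D'.modularDegree : ℝ) * (D.maninConstant : ℝ) ^ 2 =
      (D.modularDegree : ℝ) * (D'.maninConstant : ℝ) ^ 2 := by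
  have hf : D'.f = D.f := D'.isNewformOf.unique D.isNewformOf
  have hL : D'.L.lattice = D.L.lattice := D'.isNeronLattice.lattice_eq D.isNeronLattice
  have hZ := congrArg Complex.re D.zagier_degree_formula_holds
  have hZ' := congrArg Complex.re D'.zagier_degree_formula_holds
  rw [Complex.re_ofReal_mul, Complex.ofReal_re] at hZ hZ'
  rw [hf, hL] at hZ'
  have hcov : 0 < ZLattice.covolume D.L.lattice := ZLattice.covolume_pos _ _
  have h1 : (D'.deg : ℝ) * (D.c : ℝ) ^ 2 * ZLattice.covolume D.L.lattice =
      (D.deg : ℝ) * (D'.c : ℝ) ^ 2 * ZLattice.covolume D.L.lattice := by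
    calc (D'.deg : ℝ) * (D.c : ℝ) ^ 2 * ZLattice.covolume D.L.lattice
        = (D.c : ℝ) ^ 2 * ((D'.deg : ℝ) * ZLattice.covolume D.L.lattice) := by ring
      _ = (D.c : ℝ) ^ 2 * (4 * Real.pi ^ 2 * (D'.c : ℝ) ^ 2 *
            (peterssonProduct (Gamma0 N) 2 D.f D.f).re) := by rw [hZ']
      _ = (D'.c : ℝ) ^ 2 * (4 * Real.pi ^ 2 * (D.c : ℝ) ^ 2 *
            (peterssonProduct (Gamma0 N) 2 D.f D.f).re) := by ring
      _ = (D'.c : ℝ) ^ 2 * ((D.deg : ℝ) * ZLattice.covolume D.L.lattice) := by rw [hZ]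
      _ = (D.deg : ℝ) * (D'.c : ℝ) ^ 2 * ZLattice.covolume D.L.lattice := by ring
  exact mul_right_cancel₀ hcov.ne' h1

/-- **Degrees of two data compare through their Manin constants**: `deg D' = deg D · c_{D'}² / c_D²`
(`c_D ≠ 0`, `maninConstant_ne_zero_holds`). [cite: ZagierCMB1985, §1 (p. 374)] -/
theorem modularDegree_eq_mul_sq_div_sq {N : ℕ} [NeZero N] {W : WeierstrassCurve ℚ} [W.IsElliptic]
    (D D' : ModularParametrizationData W N) :
    (D'.modularDegree : ℝ) =
      (D.modularDegree : ℝ) * (D'.maninConstant : ℝ) ^ 2 / (D.maninConstant : ℝ) ^ 2 := by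
  have hc : (D.maninConstant : ℝ) ≠ 0 := by exact_mod_cast D.maninConstant_ne_zero_holds
  rw [eq_div_iff (pow_ne_zero 2 hc)]
  exact modularDegree_mul_sq_maninConstant_eq D D'

/-! ## The c²-relative per-datum Murty bound (fact-free) -/

/-- **`deg D ≤ K · c_D² · N^κ` from a height bound, for EVERY datum at square-free level** (Murty 1999, Thm. 1
(ii) / §2 with free exponents, relative to the datum's own Manin constant): `deg = 4π² c² (f,f) / covol`
(Zagier), `(f,f) ≤ C_P N (1 + log N)⁵ ≤ C₂ N^{3/2}` at square-free level, `covol⁻¹ ≤ (1729 A C_H)^{1/6} N^{σ/6}`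
(Silverman's lower covolume inequality with `max(|c₄|³,|c₆|²) ≤ 1729 · max(|Δ|,|c₄|³)`). Here
`κ = 3/2 + max(σ,0)/6` and `K = 4π² C₂ (1729 A max(C_H,0))^{1/6}`; no Manin input, no modularity, no minimality
of the model. [cite: MurtyCongruencePrimes1999, Thm. 1 (ii) and §2] -/
theorem degLe_sq_manin_of_height : ∀ σ CH : ℝ, ∃ κ K : ℝ, ∀ (N : ℕ) [NeZero N] (W : WeierstrassCurve ℚ) [W.IsElliptic] (D : Literature.NumberTheory.EllipticCurves.ModularForms.ModularParametrizationData W N), Squarefree N → ((max |W.Δ| (|W.c₄| ^ 3) : ℚ) : ℝ) ≤ CH * (N : ℝ) ^ σ → (D.modularDegree : ℝ) ≤ K * (D.maninConstant : ℝ) ^ 2 * (N : ℝ) ^ κ := by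
  intro σ CH
  obtain ⟨A, hA, hSil⟩ := covolume_rpow_neg_six_le_of_isNeronLatticeOf
  obtain ⟨CP, hCP, hPet⟩ :=
    Literature.NumberTheory.Automorphic.exists_petersson_le_mul_log_pow_of_squarefree
  -- constants
  set B : ℝ := A * (1729 * max CH 0) with hB
  have hB0 : 0 ≤ B := by positivity
  have hhalf : (0 : ℝ) < 1 / 2 := by norm_num
  set C₂ : ℝ := CP * (5 / (1 / 2 : ℝ) + 1) ^ 5 with hC₂
  have hC₂0 : 0 ≤ C₂ := by positivity
  set K : ℝ := 4 * Real.pi ^ 2 * C₂ * B ^ (1 / 6 : ℝ) with hK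
  refine ⟨(1 + 1 / 2) + max σ 0 / 6, K, fun N _ W _ D hsq hσ ↦ ?_⟩
  have hNpos : (0 : ℝ) < N := by exact_mod_cast Nat.pos_of_ne_zero (NeZero.ne N)
  have hN1 : (1 : ℝ) ≤ N := by exact_mod_cast Nat.pos_of_ne_zero (NeZero.ne N)
  -- Zagier's identity, real form
  have hZ := congrArg Complex.re D.zagier_degree_formula_holds
  rw [Complex.re_ofReal_mul, Complex.ofReal_re] at hZ
  have hP0 : 0 ≤ (peterssonProduct (Gamma0 N) 2 D.f D.f).re :=
    D.zagier_degree_formula_holds.peterssonProduct_re_pos.le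
  have hcov : 0 < ZLattice.covolume D.L.lattice := ZLattice.covolume_pos _ _
  -- Petersson upper bound at square-free level: `(f,f) ≤ CP · N (1 + log N)⁵ ≤ C₂ N^{3/2}`
  have hP : (peterssonProduct (Gamma0 N) 2 D.f D.f).re ≤ C₂ * (N : ℝ) ^ (1 + 1 / 2 : ℝ) := by
    have h1 := hPet N hsq W D.f D.isNewformOf
    have hlog : (1 + Real.log N) ^ 5 ≤ (5 / (1 / 2 : ℝ) + 1) ^ 5 * (N : ℝ) ^ (1 / 2 : ℝ) := by
      rw [add_comm]
      exact log_add_one_pow_five_le hN1 hhalf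
    have hNrpow : (N : ℝ) * (N : ℝ) ^ (1 / 2 : ℝ) = (N : ℝ) ^ (1 + 1 / 2 : ℝ) := by
      rw [Real.rpow_add hNpos, Real.rpow_one]
    calc (peterssonProduct (Gamma0 N) 2 D.f D.f).re ≤ CP * N * (1 + Real.log N) ^ 5 := h1
      _ ≤ CP * N * ((5 / (1 / 2 : ℝ) + 1) ^ 5 * (N : ℝ) ^ (1 / 2 : ℝ)) :=
          mul_le_mul_of_nonneg_left hlog (by positivity)
      _ = C₂ * ((N : ℝ) * (N : ℝ) ^ (1 / 2 : ℝ)) := by rw [hC₂]; ring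
      _ = C₂ * (N : ℝ) ^ (1 + 1 / 2 : ℝ) := by rw [hNrpow]
  -- the height hypothesis: `max(|c₄|³,|c₆|²) ≤ 1729 · max(|Δ|,|c₄|³) ≤ 1729 · max CH 0 · N^{max σ 0}`
  have hmax : ((max (|W.c₄| ^ 3) (|W.c₆| ^ 2) : ℚ) : ℝ) ≤
      1729 * max CH 0 * (N : ℝ) ^ (max σ 0) := by
    have h1 : ((max (|W.c₄| ^ 3) (|W.c₆| ^ 2) : ℚ) : ℝ) ≤ ((1729 * max |W.Δ| (|W.c₄| ^ 3) : ℚ) : ℝ) := by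
      exact_mod_cast HeightCalibration.max_abs_c₄_c₆_le_rat W
    have hNσ : (N : ℝ) ^ σ ≤ (N : ℝ) ^ (max σ 0) :=
      Real.rpow_le_rpow_of_exponent_le hN1 (le_max_left _ _)
    have h2 : ((max |W.Δ| (|W.c₄| ^ 3) : ℚ) : ℝ) ≤ max CH 0 * (N : ℝ) ^ (max σ 0) :=
      calc ((max |W.Δ| (|W.c₄| ^ 3) : ℚ) : ℝ) ≤ CH * (N : ℝ) ^ σ := hσ
        _ ≤ max CH 0 * (N : ℝ) ^ σ := mul_le_mul_of_nonneg_right (le_max_left _ _) (by positivity)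
        _ ≤ max CH 0 * (N : ℝ) ^ (max σ 0) := mul_le_mul_of_nonneg_left hNσ (le_max_right _ _)
    calc ((max (|W.c₄| ^ 3) (|W.c₆| ^ 2) : ℚ) : ℝ)
        ≤ ((1729 * max |W.Δ| (|W.c₄| ^ 3) : ℚ) : ℝ) := h1
      _ = 1729 * ((max |W.Δ| (|W.c₄| ^ 3) : ℚ) : ℝ) := by push_cast; ring
      _ ≤ 1729 * (max CH 0 * (N : ℝ) ^ (max σ 0)) := mul_le_mul_of_nonneg_left h2 (by norm_num)
      _ = 1729 * max CH 0 * (N : ℝ) ^ (max σ 0) := by ring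
  -- Silverman: `covol^{-6} ≤ A · max(|c₄|³,|c₆|²) ≤ B · (N^{max σ 0 / 6})⁶`
  have hpow : (N : ℝ) ^ (max σ 0) = ((N : ℝ) ^ (max σ 0 / 6)) ^ 6 := by
    rw [← Real.rpow_natCast, ← Real.rpow_mul hNpos.le]
    congr 1
    push_cast
    ring
  have h6 : ZLattice.covolume D.L.lattice ^ (-(6 : ℝ)) ≤ B * ((N : ℝ) ^ (max σ 0 / 6)) ^ 6 := by
    calc ZLattice.covolume D.L.lattice ^ (-(6 : ℝ))
        ≤ A * ((max (|W.c₄| ^ 3) (|W.c₆| ^ 2) : ℚ) : ℝ) := hSil W D.L D.isNeronLattice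
      _ ≤ A * (1729 * max CH 0 * (N : ℝ) ^ (max σ 0)) := mul_le_mul_of_nonneg_left hmax hA.le
      _ = B * ((N : ℝ) ^ (max σ 0 / 6)) ^ 6 := by rw [hB, hpow]; ring
  have hinv := inv_le_of_rpow_neg_six_le hcov hB0 (by positivity) h6
  -- the degree bound, relative to `|c_D|` itself
  have hdeg := deg_le_of_zagier_of_upper hcov hZ (le_refl |(D.c : ℝ)|) hP0 hP hinv
  have hexp : (N : ℝ) ^ (1 + 1 / 2 : ℝ) * (N : ℝ) ^ (max σ 0 / 6) =
      (N : ℝ) ^ ((1 + 1 / 2) + max σ 0 / 6) := by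
    rw [← Real.rpow_add hNpos]
  calc (D.modularDegree : ℝ) = (D.deg : ℝ) := rfl
    _ ≤ 4 * Real.pi ^ 2 * |(D.c : ℝ)| ^ 2 * (C₂ * (N : ℝ) ^ (1 + 1 / 2 : ℝ)) *
          (B ^ (1 / 6 : ℝ) * (N : ℝ) ^ (max σ 0 / 6)) := hdeg
    _ = K * (D.c : ℝ) ^ 2 * ((N : ℝ) ^ (1 + 1 / 2 : ℝ) * (N : ℝ) ^ (max σ 0 / 6)) := by
          rw [hK, sq_abs]; ring
    _ = K * (D.maninConstant : ℝ) ^ 2 * (N : ℝ) ^ ((1 + 1 / 2) + max σ 0 / 6) := by rw [hexp]; rfl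

/-! ## `Prel → H`: the Manin constant cancels -/

/-- **`Prel → H`**: if every semistable globally minimal elliptic `W/ℚ` has a datum `D` at level `N_W` with
`deg D ≤ C · c_D² · N^κ`, then `max(|Δ_W|, |c₄(W)|³) ≤ C' · N^{7κ − 7/4}` for all such `W` — the proof of the
landed `polyHeight_of_polyDegree` (p102896) verbatim, whose first step `deg ≤ C · N^κ ≤ C · c² · N^κ` is now the
hypothesis: Zagier `4π² c² (f,f) = deg · covol` and `(f,f) ≥ c₂ N^{1/4}` (Hoffstein–Lockhart range, tree theorem)
give `covol ≥ (4π² c₂ / C₁) · N^{−(κ − 1/4)}` with the Manin constant CANCELLED (`covolume_ge_of_zagier_exp`),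
and Silverman's `max(|Δ|,|c₄|³) ≤ A₀ · covol^{−7}` on the global minimal model finishes.
[cite: MurtyCongruencePrimes1999, Thm. 1 (i) and §2] [cite: Silverman1986, Prop. 1.1] -/
theorem polyHeight_of_polyDegreeUpToManin
    (hPrel : ∃ κ C : ℝ, ∀ (W : WeierstrassCurve ℚ) [W.IsElliptic] [W.IsGloballyMinimal]
      [NeZero (W.conductorNorm ℤ)], W.IsSemistable ℤ →
      ∃ D : ModularParametrizationData W (W.conductorNorm ℤ),
        (D.modularDegree : ℝ) ≤ C * (D.maninConstant : ℝ) ^ 2 * (W.conductorNorm ℤ : ℝ) ^ κ) :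
    ∃ σ C : ℝ, ∀ (W : WeierstrassCurve ℚ) [W.IsElliptic] [W.IsGloballyMinimal]
      [NeZero (W.conductorNorm ℤ)], W.IsSemistable ℤ →
      ((max |W.Δ| (|W.c₄| ^ 3) : ℚ) : ℝ) ≤ C * (W.conductorNorm ℤ : ℝ) ^ σ := by
  obtain ⟨κ, C, hP⟩ := hPrel
  obtain ⟨c₂, hc₂, hPet⟩ := HoffsteinLockhart1994_peterssonProduct_lower_bound_of_half_lt
    (show (1 : ℝ) / 2 < 3 / 4 by norm_num)
  obtain ⟨A₀, hA₀⟩ := silverman1986_discriminant_c4_covolume_holds 1 one_pos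
  set C₁ : ℝ := max C 1 with hC₁def
  have hC₁ : 0 < C₁ := lt_of_lt_of_le one_pos (le_max_right _ _)
  set K : ℝ := 4 * Real.pi ^ 2 * c₂ / C₁ with hKdef
  have hK : 0 < K := by positivity
  refine ⟨(κ - 1 / 4) * (6 + 1), max A₀ 0 * K ^ (-(6 + 1 : ℝ)), ?_⟩
  intro W _ _ _ hW
  obtain ⟨D, hD⟩ := hP W hW
  set N : ℕ := W.conductorNorm ℤ with hNdef
  have hN : (0 : ℝ) < N := by exact_mod_cast Nat.pos_of_ne_zero (NeZero.ne N)
  have hc : (D.c : ℝ) ≠ 0 := by exact_mod_cast D.maninConstant_ne_zero_holds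
  have hcov : 0 < ZLattice.covolume D.L.lattice := ZLattice.covolume_pos _ _
  -- Zagier's identity, real form
  have hZ := congrArg Complex.re D.zagier_degree_formula_holds
  rw [Complex.re_ofReal_mul, Complex.ofReal_re] at hZ
  -- the degree bound in `c²`-form with exponent `2 + (κ − 2)` — now the hypothesis
  have hdeg : (D.deg : ℝ) ≤ C₁ * (D.c : ℝ) ^ 2 * (N : ℝ) ^ (2 + (κ - 2)) := by
    have hN0' : (0 : ℝ) ≤ (D.c : ℝ) ^ 2 * (N : ℝ) ^ κ := by positivity
    rw [show 2 + (κ - 2) = κ by ring]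
    calc (D.deg : ℝ) = (D.modularDegree : ℝ) := rfl
      _ ≤ C * (D.maninConstant : ℝ) ^ 2 * (N : ℝ) ^ κ := hD
      _ = C * ((D.c : ℝ) ^ 2 * (N : ℝ) ^ κ) := by rw [mul_assoc]; rfl
      _ ≤ C₁ * ((D.c : ℝ) ^ 2 * (N : ℝ) ^ κ) := mul_le_mul_of_nonneg_right (le_max_left _ _) hN0'
      _ = C₁ * (D.c : ℝ) ^ 2 * (N : ℝ) ^ κ := by ring
  -- covolume lower bound (the Manin constant cancels)
  have hlow := covolume_ge_of_zagier_exp hN hC₁ hc hcov hZ hdeg (hPet N W D)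
  have hlow' : K * (N : ℝ) ^ (-(1 + (κ - 2) + 3 / 4)) ≤ ZLattice.covolume D.L.lattice := by
    rw [hKdef]; exact hlow
  have hx : 0 < K * (N : ℝ) ^ (-(1 + (κ - 2) + 3 / 4)) := by positivity
  -- Silverman on the global minimal model `W`
  have hSW := hA₀ W D.L D.isNeronLattice
  have hpos : 0 ≤ ZLattice.covolume D.L.lattice ^ (-(6 + 1 : ℝ)) := Real.rpow_nonneg hcov.le _
  have h1 : ((max |W.Δ| (|W.c₄| ^ 3) : ℚ) : ℝ) ≤
      max A₀ 0 * ZLattice.covolume D.L.lattice ^ (-(6 + 1 : ℝ)) :=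
    hSW.trans (mul_le_mul_of_nonneg_right (le_max_left _ _) hpos)
  have h2 : ZLattice.covolume D.L.lattice ^ (-(6 + 1 : ℝ)) ≤
      (K * (N : ℝ) ^ (-(1 + (κ - 2) + 3 / 4))) ^ (-(6 + 1 : ℝ)) :=
    Real.rpow_le_rpow_of_nonpos hx hlow' (by norm_num)
  have h3 : (K * (N : ℝ) ^ (-(1 + (κ - 2) + 3 / 4))) ^ (-(6 + 1 : ℝ)) =
      K ^ (-(6 + 1 : ℝ)) * (N : ℝ) ^ ((κ - 1 / 4) * (6 + 1)) := by
    rw [Real.mul_rpow hK.le (Real.rpow_nonneg hN.le _), ← Real.rpow_mul hN.le]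
    congr 1
    ring_nf
  calc ((max |W.Δ| (|W.c₄| ^ 3) : ℚ) : ℝ)
      ≤ max A₀ 0 * ZLattice.covolume D.L.lattice ^ (-(6 + 1 : ℝ)) := h1
    _ ≤ max A₀ 0 * (K * (N : ℝ) ^ (-(1 + (κ - 2) + 3 / 4))) ^ (-(6 + 1 : ℝ)) :=
        mul_le_mul_of_nonneg_left h2 (le_max_right _ _)
    _ = max A₀ 0 * K ^ (-(6 + 1 : ℝ)) * (N : ℝ) ^ ((κ - 1 / 4) * (6 + 1)) := by
        rw [h3]; ring

/-! ## `H → Prel` for every datum; `B' ↔ (A → Prel)` fact-free -/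

/-- **`H →` the Manin-relative degree bound for EVERY datum of every semistable globally minimal curve**
(`degLe_sq_manin_of_height` at the square-free level `N_W`). No modularity is needed for this direction: it is a
statement about whatever data exist. [cite: MurtyCongruencePrimes1999, Thm. 1 (ii) and §2] -/
theorem polyDegreeUpToManin_forall_of_polyHeight
    (hH : ∃ σ C : ℝ, ∀ (W : WeierstrassCurve ℚ) [W.IsElliptic] [W.IsGloballyMinimal]
      [NeZero (W.conductorNorm ℤ)], W.IsSemistable ℤ →
      ((max |W.Δ| (|W.c₄| ^ 3) : ℚ) : ℝ) ≤ C * (W.conductorNorm ℤ : ℝ) ^ σ) :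
    ∃ κ C : ℝ, ∀ (W : WeierstrassCurve ℚ) [W.IsElliptic] [W.IsGloballyMinimal]
      [NeZero (W.conductorNorm ℤ)], W.IsSemistable ℤ →
      ∀ D : ModularParametrizationData W (W.conductorNorm ℤ),
        (D.modularDegree : ℝ) ≤ C * (D.maninConstant : ℝ) ^ 2 * (W.conductorNorm ℤ : ℝ) ^ κ := by
  obtain ⟨σ, CH, hH⟩ := hH
  obtain ⟨κ, K, hK⟩ := degLe_sq_manin_of_height σ CH
  refine ⟨κ, K, fun W _ _ _ hss D ↦ ?_⟩
  exact hK (W.conductorNorm ℤ) W D ((W.isSemistable_iff_squarefree_conductorNorm).mp hss) (hH W hss)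

/-- **`H → A → Prel`**: crux A supplies a datum of every semistable globally minimal curve, and the previous
theorem bounds its degree relative to its Manin constant. [cite: MurtyCongruencePrimes1999, Thm. 1 (ii) and §2] -/
theorem polyDegreeUpToManin_of_polyHeight_of_degreePrimes
    (hH : ∃ σ C : ℝ, ∀ (W : WeierstrassCurve ℚ) [W.IsElliptic] [W.IsGloballyMinimal]
      [NeZero (W.conductorNorm ℤ)], W.IsSemistable ℤ →
      ((max |W.Δ| (|W.c₄| ^ 3) : ℚ) : ℝ) ≤ C * (W.conductorNorm ℤ : ℝ) ^ σ)
    (hA : DegreePrimesPolyBounded) :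
    ∃ κ C : ℝ, ∀ (W : WeierstrassCurve ℚ) [W.IsElliptic] [W.IsGloballyMinimal]
      [NeZero (W.conductorNorm ℤ)], W.IsSemistable ℤ →
      ∃ D : ModularParametrizationData W (W.conductorNorm ℤ),
        (D.modularDegree : ℝ) ≤ C * (D.maninConstant : ℝ) ^ 2 * (W.conductorNorm ℤ : ℝ) ^ κ := by
  obtain ⟨κ, K, h⟩ := polyDegreeUpToManin_forall_of_polyHeight hH
  obtain ⟨κA, CA, hA⟩ := hA
  refine ⟨κ, K, fun W _ _ _ hss ↦ ?_⟩
  obtain ⟨D, -⟩ := hA W hss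
  exact ⟨D, h W hss D⟩

/-- **`P → Prel`** (trivially: `c_D ∈ ℤ ∖ {0}`, so `c_D² ≥ 1`). [folklore] -/
theorem polyDegreeUpToManin_of_polyDegree
    (hP : ∃ κ C : ℝ, ∀ (W : WeierstrassCurve ℚ) [W.IsElliptic] [W.IsGloballyMinimal]
      [NeZero (W.conductorNorm ℤ)], W.IsSemistable ℤ →
      ∃ D : ModularParametrizationData W (W.conductorNorm ℤ),
        (D.modularDegree : ℝ) ≤ C * (W.conductorNorm ℤ : ℝ) ^ κ) :
    ∃ κ C : ℝ, ∀ (W : WeierstrassCurve ℚ) [W.IsElliptic] [W.IsGloballyMinimal]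
      [NeZero (W.conductorNorm ℤ)], W.IsSemistable ℤ →
      ∃ D : ModularParametrizationData W (W.conductorNorm ℤ),
        (D.modularDegree : ℝ) ≤ C * (D.maninConstant : ℝ) ^ 2 * (W.conductorNorm ℤ : ℝ) ^ κ := by
  obtain ⟨κ, C, hP⟩ := hP
  refine ⟨κ, max C 0, fun W _ _ _ hss ↦ ?_⟩
  obtain ⟨D, hD⟩ := hP W hss
  refine ⟨D, ?_⟩
  have hc1 : (1 : ℝ) ≤ (D.maninConstant : ℝ) ^ 2 := by
    have h0 : D.maninConstant ≠ 0 := D.maninConstant_ne_zero_holds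
    have h1 : (1 : ℤ) ≤ D.maninConstant ^ 2 := by nlinarith [Int.one_le_abs h0, sq_abs D.maninConstant]
    exact_mod_cast h1
  have hNκ : (0 : ℝ) ≤ (W.conductorNorm ℤ : ℝ) ^ κ := by positivity
  calc (D.modularDegree : ℝ) ≤ C * (W.conductorNorm ℤ : ℝ) ^ κ := hD
    _ ≤ max C 0 * (W.conductorNorm ℤ : ℝ) ^ κ := mul_le_mul_of_nonneg_right (le_max_left _ _) hNκ
    _ = max C 0 * 1 * (W.conductorNorm ℤ : ℝ) ^ κ := by ring
    _ ≤ max C 0 * (D.maninConstant : ℝ) ^ 2 * (W.conductorNorm ℤ : ℝ) ^ κ :=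
        mul_le_mul_of_nonneg_right (mul_le_mul_of_nonneg_left hc1 (le_max_right _ _)) hNκ

/-- **`B' ↔ (A → Prel)` — FACT-FREE** ★: the height re-cut of crux B (the sibling crux
`PolyHeightOfBoundedPrimes`, stmt-ABC-16006) is EQUIVALENT, with no named fact, no Manin input and no route item,
to "crux A ⟹ every semistable globally minimal curve has a datum with `deg ≤ C · c² · N^κ`". So B' is crux B
with `deg` replaced by the Manin-free quotient `deg / c²` (`= 4π² (f,f) / covol(Λ_W)`, an invariant of the
curve by `modularDegree_mul_sq_maninConstant_eq`). [cite: MurtyCongruencePrimes1999, Thm. 1 and §2]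
[cite: PastenShimura2024, §3 p. 13] -/
theorem polyHeightOfBoundedPrimes_iff_polyDegreeUpToManin : Summit.ABC.ABC.Theses.IsogenyGlueCongruence.PolyHeightOfBoundedPrimes ↔ (Summit.ABC.ABC.Theses.IsogenyGlueCongruence.DegreePrimesPolyBounded → ∃ κ C : ℝ, ∀ (W : WeierstrassCurve ℚ) [W.IsElliptic] [W.IsGloballyMinimal] [NeZero (W.conductorNorm ℤ)], W.IsSemistable ℤ → ∃ D : Literature.NumberTheory.EllipticCurves.ModularForms.ModularParametrizationData W (W.conductorNorm ℤ), (D.modularDegree : ℝ) ≤ C * (D.maninConstant : ℝ) ^ 2 * (W.conductorNorm ℤ : ℝ) ^ κ) :=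
  ⟨fun hB' hA ↦ polyDegreeUpToManin_of_polyHeight_of_degreePrimes (hB' hA) hA,
    fun h hA ↦ polyHeight_of_polyDegreeUpToManin (h hA)⟩

/-- **`B' ↔ (A → Prel for EVERY datum)`**, the universal form (also fact-free): granted A, bounding `deg/c²` of
some datum and of all data are the same, because a datum exists (A) and `deg/c²` does not depend on the datum.
[cite: MurtyCongruencePrimes1999, Thm. 1 and §2] -/
theorem polyHeightOfBoundedPrimes_iff_polyDegreeUpToManin_forall :
    PolyHeightOfBoundedPrimes ↔ (DegreePrimesPolyBounded →
      ∃ κ C : ℝ, ∀ (W : WeierstrassCurve ℚ) [W.IsElliptic] [W.IsGloballyMinimal]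
        [NeZero (W.conductorNorm ℤ)], W.IsSemistable ℤ →
        ∀ D : ModularParametrizationData W (W.conductorNorm ℤ),
          (D.modularDegree : ℝ) ≤ C * (D.maninConstant : ℝ) ^ 2 * (W.conductorNorm ℤ : ℝ) ^ κ) := by
  refine ⟨fun hB' hA ↦ polyDegreeUpToManin_forall_of_polyHeight (hB' hA), fun h hA ↦ ?_⟩
  obtain ⟨κ, K, hK⟩ := h hA
  obtain ⟨κA, CA, hA'⟩ := hA
  refine polyHeight_of_polyDegreeUpToManin ⟨κ, K, fun W _ _ _ hss ↦ ?_⟩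
  obtain ⟨D, -⟩ := hA' W hss
  exact ⟨D, hK W hss D⟩

end Summit.ABC.ABC.Theorems

end
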